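import Summits.QuantumFields.YangMills.Theorems.AllWindowsColdBoxBoxHighLineStep2Kernels
import Summits.QuantumFields.YangMills.Theorems.AllWindowsColdBoxBoxHighLineDirichletGreenHilbertSchmidt

/-!
# T-S5.8a `cubeShellSums : CubeShellSums` — single shell sums over the cube `[0,N]⁴`, uniformly in the centre

Planner ym-idea-2 g18's typed task `Cruxes/BoxHighWindowsSU22/TaskS5Step2Kernels.lean` (commit 51ce4044ffc9), STEP 2 of the XL stub S5
`stub_landauSecondOrder` (LINE-19 ⟨stmt-QuantumFields-24004⟩/⟨24335⟩); the Prop `CubeShellSums` is the tree copy in ✓`…Step2Kernels`: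
`Σ_{p ∈ [0,N]⁴} (1+d(p,x))⁻² ≤ C N²`, `Σ (1+d(p,x))⁻⁴ ≤ C(1 + log N)`, `Σ (1+d(p,x))⁻⁵ ≤ C`, UNIFORMLY in `x ∈ ℤ⁴` (`N ≥ 1`; here `C = 224`).

Proof (shell counting, the route the task names).  `d(p,x) = supNorm (p − x)` (`siteDist_eq_supNorm`); decompose the sum along the fibres
`k = supNorm (p − x)` (`Finset.sum_fiberwise_of_maps_to'`).  Two cardinality bounds for the fibre `{p ∈ [0,N]⁴ : supNorm(p − x) = k}`:
(A) `≤ 8(2k+1)³ ≤ 64(k+1)³` — translate into the sup-norm shell of `ℤ⁴` and use ✓`Beta.PoissonInterior.card_shell_le` (`k ≥ 1`; `≤ 1` for `k = 0`);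
(B) `≤ 8(N+1)³` — one coordinate is pinned to `x_i ± k`.  Then `a = 5`: (A) and `Σ 1/(k+1)² ≤ 2` (the tail lemma `Σ_{k>N} (1+k)⁻² ≤ 1/(N+1)` at `N = 0`); `a = 4`: (A) up to `k = N` with the harmonic sum
(✓`DirichletGreenHilbertSchmidt.sum_inv_one_add_le`) and (B) beyond with `Σ_{k>N} (1+k)⁻² ≤ 1/(N+1)`; `a = 2`: (A) up to `N` (`Σ (k+1) ≤ (N+1)²`) and
(B) beyond.

Tree (✓…Step2Kernels, ✓…DirichletGreenHilbertSchmidt, ✓Literature `Beta.PoissonInterior`) + Mathlib; no definitions; standard axioms.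
HONEST LABEL: an M-sized support lemma of STEP 2 of the XL stub S5; S5, U5, ⟨24004⟩ ⟨24335⟩ ⟨24336⟩ remain OPEN; route AllWindowsColdBox is DRAFT;
no summit is proved; the Yang–Mills mass gap is NOT proved by this file.  Seat ym-line-sfw-p2-w5 g21 (cell ym-idea-1).
-/

set_option autoImplicit false

noncomputable section

open Real Finset
open Literature.Probability.LatticeModels (Site)
open Literature.MathematicalPhysics.QuantumFieldTheory.Balaban1983to89.Beta.PoissonInterior (cube supNorm card_shell_le mem_cube_zero_iff
  exists_natAbs_eq_supNorm natAbs_le_supNorm supNorm_eq_zero_iff)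

namespace Summit.QuantumFields.YangMills.Theorems.AllWindowsColdBoxBoxHighLine

namespace CubeShell

/-! ## `siteDist = supNorm` -/

/-- `d(p,x) = supNorm (p − x)`. -/
theorem siteDist_eq_supNorm (p x : Site 4) : siteDist p x = (supNorm (p - x) : ℝ) := by
  refine le_antisymm (GhostKernel.siteDist_le_supNorm p x) ?_
  obtain ⟨i, hi⟩ := exists_natAbs_eq_supNorm (d := 4) (by norm_num) (p - x)
  unfold siteDist
  have h1 : (supNorm (p - x) : ℝ) = |((p i - x i : ℤ) : ℝ)| := by
    rw [← hi, Nat.cast_natAbs, Int.cast_abs, Pi.sub_apply]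
  rw [h1]
  exact le_ciSup (f := fun k : Fin 4 => |((p k - x k : ℤ) : ℝ)|) (Set.finite_range _).bddAbove i

/-! ## Fibre cardinalities -/

/-- (A) The fibre `{p ∈ S : supNorm (p − x) = k}` injects into the sup-norm shell of radius `k ≥ 1` of `ℤ⁴`: `≤ 8(2k+1)³`. -/
theorem card_fibre_le_shell (S : Finset (Site 4)) (x : Site 4) {k : ℕ} (hk : 1 ≤ k) :
    ((S.filter fun p => supNorm (p - x) = k).card : ℝ) ≤ 8 * (2 * k + 1) ^ 3 := by
  have hmaps : Set.MapsTo (fun p : Site 4 => p - x) ↑(S.filter fun p => supNorm (p - x) = k)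
      ↑((cube (0 : Site 4) k).filter fun z => supNorm z = k) := by
    intro p hp
    have hp' := (Finset.mem_filter.1 (Finset.mem_coe.1 hp)).2
    rw [Finset.mem_coe, Finset.mem_filter, mem_cube_zero_iff]
    exact ⟨hp'.le, hp'⟩
  have hinj : Set.InjOn (fun p : Site 4 => p - x) ↑(S.filter fun p => supNorm (p - x) = k) := fun p _ q _ h => sub_left_injective h
  have h1 := Finset.card_le_card_of_injOn _ hmaps hinj
  have h2 := card_shell_le (d := 4) (by norm_num) k k hk
  calc ((S.filter fun p => supNorm (p - x) = k).card : ℝ) ≤ (((cube (0 : Site 4) k).filter fun z => supNorm z = k).card : ℝ) := by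
        exact_mod_cast h1
    _ ≤ 2 * (4 : ℕ) * (2 * k + 1) ^ (4 - 1) := h2
    _ = 8 * (2 * k + 1) ^ 3 := by norm_num

/-- The fibre over `k = 0` is at most `{x}`. -/
theorem card_fibre_zero_le (S : Finset (Site 4)) (x : Site 4) : ((S.filter fun p => supNorm (p - x) = 0).card : ℝ) ≤ 1 := by
  have h : (S.filter fun p => supNorm (p - x) = 0) ⊆ {x} := by
    intro p hp
    rw [Finset.mem_filter, supNorm_eq_zero_iff, sub_eq_zero] at hp
    rw [Finset.mem_singleton]; exact hp.2
  exact_mod_cast (Finset.card_le_card h).trans (by simp)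

/-- (A′) Uniform form: `#fibre_k ≤ 64 (k+1)³` for every `k`. -/
theorem card_fibre_le (S : Finset (Site 4)) (x : Site 4) (k : ℕ) :
    ((S.filter fun p => supNorm (p - x) = k).card : ℝ) ≤ 64 * ((k : ℝ) + 1) ^ 3 := by
  rcases Nat.eq_zero_or_pos k with rfl | hk
  · refine (card_fibre_zero_le S x).trans ?_
    norm_num
  · refine (card_fibre_le_shell S x hk).trans ?_
    have hk0 : (0 : ℝ) ≤ k := by positivity
    nlinarith [hk0, sq_nonneg ((k : ℝ) + 1)]

/-- A coordinate slice of the cube `[0,N]⁴` has at most `(N+1)³` points. -/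
theorem card_cubeSites_filter_apply_eq_le (N : ℕ) (i : Fin 4) (c : ℤ) :
    ((cubeSites N).filter fun p => p i = c).card ≤ (N + 1) ^ 3 := by
  classical
  have hsub : ((cubeSites N).filter fun p => p i = c) ⊆
      Fintype.piFinset fun i' => if i' = i then ({c} : Finset ℤ) else Finset.Icc (0 : ℤ) N := by
    intro p hp
    rw [Finset.mem_filter, cubeSites, Fintype.mem_piFinset] at hp
    rw [Fintype.mem_piFinset]
    intro i'
    by_cases h : i' = i
    · subst h; rw [if_pos rfl, Finset.mem_singleton]; exact hp.2
    · rw [if_neg h]; exact hp.1 i'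
  refine (Finset.card_le_card hsub).trans ?_
  rw [Fintype.card_piFinset, ← Finset.mul_prod_erase Finset.univ _ (Finset.mem_univ i), if_pos rfl, Finset.card_singleton, one_mul]
  have h2 : ∀ i' ∈ Finset.univ.erase i, (if i' = i then ({c} : Finset ℤ) else Finset.Icc (0 : ℤ) N).card = N + 1 := by
    intro i' hi'
    rw [Finset.mem_erase] at hi'
    rw [if_neg hi'.1, Int.card_Icc]; omega
  rw [Finset.prod_congr rfl h2, Finset.prod_const, Finset.card_erase_of_mem (Finset.mem_univ i), Finset.card_univ, Fintype.card_fin]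

/-- (B) The fibre is contained in the `8` coordinate slices `p_i = x_i ± k`: `#fibre_k ≤ 8(N+1)³`. -/
theorem card_fibre_le_faces (N : ℕ) (x : Site 4) (k : ℕ) :
    (((cubeSites N).filter fun p => supNorm (p - x) = k).card : ℝ) ≤ 8 * ((N : ℝ) + 1) ^ 3 := by
  classical
  have hsub : ((cubeSites N).filter fun p => supNorm (p - x) = k) ⊆
      Finset.univ.biUnion fun i : Fin 4 =>
        ((cubeSites N).filter fun p => p i = x i + k) ∪ ((cubeSites N).filter fun p => p i = x i - k) := by
    intro p hp
    rw [Finset.mem_filter] at hp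
    obtain ⟨i, hi⟩ := exists_natAbs_eq_supNorm (d := 4) (by norm_num) (p - x)
    rw [hp.2, Pi.sub_apply] at hi
    rw [Finset.mem_biUnion]
    refine ⟨i, Finset.mem_univ i, ?_⟩
    rw [Finset.mem_union, Finset.mem_filter, Finset.mem_filter]
    rcases Int.natAbs_eq (p i - x i) with h | h
    · left; exact ⟨hp.1, by rw [hi] at h; omega⟩
    · right; exact ⟨hp.1, by rw [hi] at h; omega⟩
  have h1 := Finset.card_le_card hsub
  have h2 : (Finset.univ.biUnion fun i : Fin 4 =>
      ((cubeSites N).filter fun p => p i = x i + k) ∪ ((cubeSites N).filter fun p => p i = x i - k)).card ≤ 4 * (2 * (N + 1) ^ 3) := by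
    calc _ ≤ ∑ i : Fin 4, (((cubeSites N).filter fun p => p i = x i + k) ∪ ((cubeSites N).filter fun p => p i = x i - k)).card :=
          Finset.card_biUnion_le
      _ ≤ ∑ _i : Fin 4, 2 * (N + 1) ^ 3 := Finset.sum_le_sum fun i _ =>
          (Finset.card_union_le _ _).trans (by
            have ha := card_cubeSites_filter_apply_eq_le N i (x i + k)
            have hb := card_cubeSites_filter_apply_eq_le N i (x i - k)
            omega)
      _ = 4 * (2 * (N + 1) ^ 3) := by simp
  have h3 : (((cubeSites N).filter fun p => supNorm (p - x) = k).card : ℝ) ≤ ((4 * (2 * (N + 1) ^ 3) : ℕ) : ℝ) := by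
    exact_mod_cast h1.trans h2
  refine h3.trans (le_of_eq ?_)
  push_cast; ring

/-! ## One-dimensional sums -/

/-- Tail: `Σ_{N<k<K} 1/(1+k)² ≤ 1/(N+1)` (any `K`). -/
theorem sum_Ico_inv_sq_le (N K : ℕ) : ∑ k ∈ Finset.Ico (N + 1) K, 1 / ((k : ℝ) + 1) ^ 2 ≤ 1 / ((N : ℝ) + 1) := by
  rcases le_or_gt K (N + 1) with hK | hK
  · rw [Finset.Ico_eq_empty_of_le hK, Finset.sum_empty]; positivity
  · suffices h : ∀ K : ℕ, N + 1 ≤ K → ∑ k ∈ Finset.Ico (N + 1) K, 1 / ((k : ℝ) + 1) ^ 2 ≤ 1 / ((N : ℝ) + 1) - 1 / (K : ℝ) by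
      have hK' : (0 : ℝ) < K := by exact_mod_cast (Nat.zero_lt_of_lt hK)
      exact (h K hK.le).trans (by linarith [one_div_pos.2 hK'])
    intro K hK
    induction K, hK using Nat.le_induction with
    | base => simp
    | succ n hn ih =>
      rw [Finset.sum_Ico_succ_top hn]
      have hn0 : (0 : ℝ) < n := by exact_mod_cast (Nat.lt_of_lt_of_le (Nat.succ_pos N) hn)
      have key : 1 / ((n : ℝ) + 1) ^ 2 ≤ 1 / n - 1 / ((n : ℝ) + 1) := by
        rw [div_sub_div _ _ hn0.ne' (by positivity), div_le_div_iff₀ (by positivity) (by positivity)]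
        nlinarith
      push_cast
      linarith

/-! ## The fibre decomposition and the three estimates -/

/-- **Fibre decomposition with both cardinality bounds**: for `g ≥ 0`,
`Σ_{p ∈ [0,N]⁴} g(supNorm(p − x)) ≤ Σ_{k ≤ N} 64(k+1)³ g(k) + 8(N+1)³ Σ_{N < k < K+1} g(k)` for some `K`. -/
theorem sum_cube_le (N : ℕ) (x : Site 4) (g : ℕ → ℝ) (hg : ∀ k, 0 ≤ g k) :
    ∃ K : ℕ, ∑ p ∈ cubeSites N, g (supNorm (p - x)) ≤
      ∑ k ∈ Finset.range (N + 1), 64 * ((k : ℝ) + 1) ^ 3 * g k + 8 * ((N : ℝ) + 1) ^ 3 * ∑ k ∈ Finset.Ico (N + 1) (K + 1), g k := by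
  classical
  set K := (cubeSites N).sup fun p => supNorm (p - x) with hK
  refine ⟨K, ?_⟩
  have hmaps : ∀ p ∈ cubeSites N, supNorm (p - x) ∈ Finset.range (K + 1) := fun p hp =>
    Finset.mem_range.2 (Nat.lt_succ_of_le (Finset.le_sup (f := fun p => supNorm (p - x)) hp))
  rw [← Finset.sum_fiberwise_of_maps_to' hmaps]
  -- each fibre contributes `#fibre_k · g k`
  have hfib : ∀ k, ∑ p ∈ (cubeSites N).filter (fun p => supNorm (p - x) = k), g k =
      ((cubeSites N).filter fun p => supNorm (p - x) = k).card * g k := fun k => by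
    rw [Finset.sum_const, nsmul_eq_mul]
  simp_rw [hfib]
  -- split `range (K+1)` at `N+1`
  have hsplit : ∀ k ∈ Finset.range (K + 1), (((cubeSites N).filter fun p => supNorm (p - x) = k).card : ℝ) * g k ≤
      (if k < N + 1 then 64 * ((k : ℝ) + 1) ^ 3 * g k else 0) + (if N + 1 ≤ k then 8 * ((N : ℝ) + 1) ^ 3 * g k else 0) := by
    intro k _
    by_cases hk : k < N + 1
    · rw [if_pos hk, if_neg (not_le.2 hk), add_zero]
      exact mul_le_mul_of_nonneg_right (card_fibre_le _ x k) (hg k)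
    · rw [if_neg hk, if_pos (not_lt.1 hk), zero_add]
      exact mul_le_mul_of_nonneg_right (card_fibre_le_faces N x k) (hg k)
  refine (Finset.sum_le_sum hsplit).trans ?_
  rw [Finset.sum_add_distrib, ← Finset.sum_filter, ← Finset.sum_filter]
  refine add_le_add ?_ ?_
  · refine Finset.sum_le_sum_of_subset_of_nonneg (fun k hk => ?_) fun k _ _ => by have := hg k; positivity
    rw [Finset.mem_filter, Finset.mem_range] at hk
    exact Finset.mem_range.2 hk.2
  · rw [Finset.mul_sum]
    refine Finset.sum_le_sum_of_subset_of_nonneg (fun k hk => ?_) fun k _ _ => by have := hg k; positivity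
    rw [Finset.mem_filter, Finset.mem_range] at hk
    exact Finset.mem_Ico.2 ⟨hk.2, hk.1⟩

end CubeShell

open CubeShell

/-- **T-S5.8a: the three shell sums** (`C = 224`). -/
theorem cubeShellSums : CubeShellSums := by
  refine ⟨224, fun N hN x => ?_⟩
  have hN1 : (1 : ℝ) ≤ N := by exact_mod_cast hN
  have hlogN : 0 ≤ Real.log (N : ℝ) := Real.log_natCast_nonneg N
  -- rewrite the summands through `supNorm`
  have hre : ∀ (a : ℕ) (p : Site 4), 1 / (1 + siteDist p x) ^ a = (fun k : ℕ => 1 / (1 + (k : ℝ)) ^ a) (supNorm (p - x)) := by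
    intro a p; simp only [siteDist_eq_supNorm]
  have hg : ∀ (a : ℕ) (k : ℕ), 0 ≤ (fun k : ℕ => 1 / (1 + (k : ℝ)) ^ a) k := fun a k => by positivity
  refine ⟨?_, ?_, ?_⟩
  · -- a = 2
    simp_rw [hre 2]
    obtain ⟨K, hK⟩ := sum_cube_le N x _ (hg 2)
    refine hK.trans ?_
    have h1 : ∑ k ∈ Finset.range (N + 1), 64 * ((k : ℝ) + 1) ^ 3 * (1 / (1 + (k : ℝ)) ^ 2) =
        ∑ k ∈ Finset.range (N + 1), 64 * ((k : ℝ) + 1) := by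
      refine Finset.sum_congr rfl fun k _ => ?_
      have : (0 : ℝ) < (k : ℝ) + 1 := by positivity
      field_simp
      ring
    have h2 : ∀ n : ℕ, ∑ k ∈ Finset.range (n + 1), 64 * ((k : ℝ) + 1) = 32 * ((n : ℝ) + 1) * ((n : ℝ) + 2) := by
      intro n
      induction n with
      | zero => norm_num
      | succ n ih => rw [Finset.sum_range_succ, ih]; push_cast; ring
    have h3 : ∑ k ∈ Finset.Ico (N + 1) (K + 1), 1 / (1 + (k : ℝ)) ^ 2 ≤ 1 / ((N : ℝ) + 1) := by
      have := sum_Ico_inv_sq_le N (K + 1)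
      refine le_trans (le_of_eq (Finset.sum_congr rfl fun k _ => by rw [add_comm])) this
    rw [h1, h2 N]
    have h4 : 8 * ((N : ℝ) + 1) ^ 3 * ∑ k ∈ Finset.Ico (N + 1) (K + 1), 1 / (1 + (k : ℝ)) ^ 2 ≤ 8 * ((N : ℝ) + 1) ^ 2 := by
      calc _ ≤ 8 * ((N : ℝ) + 1) ^ 3 * (1 / ((N : ℝ) + 1)) := mul_le_mul_of_nonneg_left h3 (by positivity)
        _ = 8 * ((N : ℝ) + 1) ^ 2 := by field_simp
    nlinarith [h4, hN1, mul_nonneg (sub_nonneg.2 hN1) (show (0 : ℝ) ≤ 184 * N + 72 by positivity)]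
  · -- a = 4
    simp_rw [hre 4]
    obtain ⟨K, hK⟩ := sum_cube_le N x _ (hg 4)
    refine hK.trans ?_
    have h1 : ∑ k ∈ Finset.range (N + 1), 64 * ((k : ℝ) + 1) ^ 3 * (1 / (1 + (k : ℝ)) ^ 4) =
        64 * ∑ k ∈ Finset.range (N + 1), 1 / (1 + (k : ℝ)) := by
      rw [Finset.mul_sum]
      refine Finset.sum_congr rfl fun k _ => ?_
      have : (0 : ℝ) < (k : ℝ) + 1 := by positivity
      field_simp
      ring
    have h2 : ∑ k ∈ Finset.range (N + 1), 1 / (1 + (k : ℝ)) ≤ 2 * (1 + Real.log N) := by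
      have h := DirichletGreenHilbertSchmidt.sum_inv_one_add_le (N + 1)
      have hlog : Real.log ((N + 1 : ℕ) : ℝ) ≤ 1 + Real.log N := by
        have hN0 : (0 : ℝ) < N := by linarith
        push_cast
        calc Real.log ((N : ℝ) + 1) ≤ Real.log (2 * N) := Real.log_le_log (by positivity) (by linarith)
          _ = Real.log 2 + Real.log N := Real.log_mul (by norm_num) hN0.ne'
          _ ≤ 1 + Real.log N := by linarith [Real.log_le_sub_one_of_pos (show (0:ℝ) < 2 by norm_num)]
      linarith
    have h3 : ∑ k ∈ Finset.Ico (N + 1) (K + 1), 1 / (1 + (k : ℝ)) ^ 4 ≤ 1 / ((N : ℝ) + 1) ^ 3 := by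
      have hterm : ∀ k ∈ Finset.Ico (N + 1) (K + 1), 1 / (1 + (k : ℝ)) ^ 4 ≤ 1 / ((N : ℝ) + 1) ^ 2 * (1 / ((k : ℝ) + 1) ^ 2) := by
        intro k hk
        have hk' : ((N : ℝ) + 1) ≤ (k : ℝ) := by exact_mod_cast (Finset.mem_Ico.1 hk).1
        rw [one_div_mul_one_div, div_le_div_iff₀ (by positivity) (by positivity), one_mul, one_mul]
        have hk1 : ((N : ℝ) + 1) ^ 2 ≤ (1 + (k : ℝ)) ^ 2 := pow_le_pow_left₀ (by positivity) (by linarith) 2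
        calc ((N : ℝ) + 1) ^ 2 * ((k : ℝ) + 1) ^ 2 ≤ (1 + (k : ℝ)) ^ 2 * ((k : ℝ) + 1) ^ 2 :=
              mul_le_mul_of_nonneg_right hk1 (sq_nonneg _)
          _ = (1 + (k : ℝ)) ^ 4 := by ring
      calc ∑ k ∈ Finset.Ico (N + 1) (K + 1), 1 / (1 + (k : ℝ)) ^ 4
          ≤ ∑ k ∈ Finset.Ico (N + 1) (K + 1), 1 / ((N : ℝ) + 1) ^ 2 * (1 / ((k : ℝ) + 1) ^ 2) := Finset.sum_le_sum hterm
        _ = 1 / ((N : ℝ) + 1) ^ 2 * ∑ k ∈ Finset.Ico (N + 1) (K + 1), 1 / ((k : ℝ) + 1) ^ 2 := by rw [Finset.mul_sum]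
        _ ≤ 1 / ((N : ℝ) + 1) ^ 2 * (1 / ((N : ℝ) + 1)) := mul_le_mul_of_nonneg_left (sum_Ico_inv_sq_le N (K + 1)) (by positivity)
        _ = 1 / ((N : ℝ) + 1) ^ 3 := by rw [one_div_mul_one_div]; ring
    rw [h1]
    have h4 : 8 * ((N : ℝ) + 1) ^ 3 * ∑ k ∈ Finset.Ico (N + 1) (K + 1), 1 / (1 + (k : ℝ)) ^ 4 ≤ 8 := by
      calc _ ≤ 8 * ((N : ℝ) + 1) ^ 3 * (1 / ((N : ℝ) + 1) ^ 3) := mul_le_mul_of_nonneg_left h3 (by positivity)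
        _ = 8 := by field_simp
    nlinarith [h2, h4, hlogN]
  · -- a = 5
    simp_rw [hre 5]
    obtain ⟨K, hK⟩ := sum_cube_le N x _ (hg 5)
    refine hK.trans ?_
    have h1 : ∑ k ∈ Finset.range (N + 1), 64 * ((k : ℝ) + 1) ^ 3 * (1 / (1 + (k : ℝ)) ^ 5) =
        64 * ∑ k ∈ Finset.range (N + 1), 1 / ((k : ℝ) + 1) ^ 2 := by
      rw [Finset.mul_sum]
      refine Finset.sum_congr rfl fun k _ => ?_
      have : (0 : ℝ) < (k : ℝ) + 1 := by positivity
      field_simp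
      ring
    -- `Σ_{k ≤ N} 1/(k+1)² ≤ 2` (folklore; the `k = 0` term plus the tail lemma at `N = 0`)
    have h2 : ∑ k ∈ Finset.range (N + 1), 1 / ((k : ℝ) + 1) ^ 2 ≤ 2 := by
      rw [Finset.range_eq_Ico, Finset.sum_eq_sum_Ico_succ_bot (Nat.succ_pos N)]
      have h := sum_Ico_inv_sq_le 0 (N + 1)
      simp only [Nat.cast_zero, zero_add, one_pow, div_one] at h ⊢
      linarith
    have h3 : ∑ k ∈ Finset.Ico (N + 1) (K + 1), 1 / (1 + (k : ℝ)) ^ 5 ≤ 1 / ((N : ℝ) + 1) ^ 3 := by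
      have hterm : ∀ k ∈ Finset.Ico (N + 1) (K + 1), 1 / (1 + (k : ℝ)) ^ 5 ≤ 1 / ((N : ℝ) + 1) ^ 3 * (1 / ((k : ℝ) + 1) ^ 2) := by
        intro k hk
        have hk' : ((N : ℝ) + 1) ≤ (k : ℝ) := by exact_mod_cast (Finset.mem_Ico.1 hk).1
        rw [one_div_mul_one_div, div_le_div_iff₀ (by positivity) (by positivity), one_mul, one_mul]
        have hk1 : ((N : ℝ) + 1) ^ 3 ≤ (1 + (k : ℝ)) ^ 3 := pow_le_pow_left₀ (by positivity) (by linarith) 3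
        calc ((N : ℝ) + 1) ^ 3 * ((k : ℝ) + 1) ^ 2 ≤ (1 + (k : ℝ)) ^ 3 * ((k : ℝ) + 1) ^ 2 :=
              mul_le_mul_of_nonneg_right hk1 (sq_nonneg _)
          _ = (1 + (k : ℝ)) ^ 5 := by ring
      calc ∑ k ∈ Finset.Ico (N + 1) (K + 1), 1 / (1 + (k : ℝ)) ^ 5
          ≤ ∑ k ∈ Finset.Ico (N + 1) (K + 1), 1 / ((N : ℝ) + 1) ^ 3 * (1 / ((k : ℝ) + 1) ^ 2) := Finset.sum_le_sum hterm
        _ = 1 / ((N : ℝ) + 1) ^ 3 * ∑ k ∈ Finset.Ico (N + 1) (K + 1), 1 / ((k : ℝ) + 1) ^ 2 := by rw [Finset.mul_sum]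
        _ ≤ 1 / ((N : ℝ) + 1) ^ 3 * (1 / ((N : ℝ) + 1)) := mul_le_mul_of_nonneg_left (sum_Ico_inv_sq_le N (K + 1)) (by positivity)
        _ ≤ 1 / ((N : ℝ) + 1) ^ 3 := by
            refine mul_le_of_le_one_right (by positivity) ?_
            rw [div_le_one (by positivity)]; linarith
    rw [h1]
    have h4 : 8 * ((N : ℝ) + 1) ^ 3 * ∑ k ∈ Finset.Ico (N + 1) (K + 1), 1 / (1 + (k : ℝ)) ^ 5 ≤ 8 := by
      calc _ ≤ 8 * ((N : ℝ) + 1) ^ 3 * (1 / ((N : ℝ) + 1) ^ 3) := mul_le_mul_of_nonneg_left h3 (by positivity)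
        _ = 8 := by field_simp
    linarith

end Summit.QuantumFields.YangMills.Theorems.AllWindowsColdBoxBoxHighLine

end
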